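import Summits.HubbardSuperconductivity.HubbardLadder.Bounds.StiffnessFromEnergyBracketsTL
import Literature.MathematicalPhysics.QuantumLattice.HartreeFockSDWThermodynamicLimit
import HarnessLib

/-!
# Hubbard ladder — Bounds: strong-coupling (Mott-proximity) stiffness ceilings, part 2 —
# half-filled torus: closed-form Langer–Mattis / SDW brackets `⇒ ρ_s ≲ 8 t²/U` (bounds.tex Thm 7(v–vi))

HONEST FRAMING (cell pub-hubbard): ladder R1–R4 with certified numbers; no claim on H/H₀. These
are bounds for a MODEL CLASS (the half-filled square-lattice Hubbard torus `hubbardTorus 2 L 1 U`,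
`t = 1`, `t' = 0`, even `L ≥ 4`, every `U > 0`, and its thermodynamic limit); no materials claim.
Companion text `pub-hubbard/paper/bounds.tex` §7 (Thm 7); tables `pub-hubbard-bounds/BOUNDS.md`
(row T5). Part 1 = `StrongCouplingStiffnessCeiling.lean` (hole–doublon counting, every filling).

## What is proved (no `sorry`, no new axioms)

The tree's chord hook `StiffnessCeilingFromEnergyBrackets` (`ρ_s L² ≤ (U (R - L₁)/(U - U₁) - Em)/4`)
is fed CLOSED-FORM sector-energy brackets valid for every even torus and every `U`, obtained from
two kernel facts of the tree by first-order moment (Jensen / tangent-line) majorants that use only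
`Σ_k ε_k² = 4 L²` (`ε_k = 2(cos k₁ + cos k₂)`; `sum_cosSum_sq`, every `L ≥ 3`):
* `hubbardTorus_groundEnergyAt_ge_lmClosed` — Langer–Mattis–Kennedy–Lieb torus bound
  (`LangerMattis.hubbardTorus_groundEnergyAt_ge`) + `√y ≤ (y + r²)/(2r)`:
  `E_L(N) ≥ (U/2) N - (U/4) L² - L² √(4 + U²/16)`; at half filling
  `E_L(L²)/L² ≥ lmClosed U := U/4 - √(4 + U²/16) = -16/(U + √(U² + 64))` (`≈ -8/U`).
* `hubbardTorus_groundEnergyAt_le_sdwClosed` — SDW Hartree–Fock bound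
  (`HartreeFock.hubbardTorus_groundEnergyAt_le_sdw_momentum`) + `ε_k² ≤ 16` + the tangent-line
  minorant of `x ↦ 1/√(x + Δ²)` at the mean `x = 4`:
  `E_L(L²)/L² ≤ sdwClosed U Δ := -4/√(16 + Δ²) + U/(4 + Δ²)` (`U ≥ 0`, `Δ ≠ 0`; `≈ -4/U` at `Δ = U/2`).
* `energyDensity2D_one_ge_lmClosed`, `energyDensity2D_one_le_sdwClosed` — the same brackets for the
  thermodynamic-limit energy density `e(U, n = 1)` (Ruelle limit along even tori).
* `MottStiffnessCeiling` (`@[conjecture] def`, PROVED by `…_holds`; finite even torus `L ≥ 3`,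
  `0 ≤ U₁ < U`, `Δ ≠ 0`): every flux stiffness `ρ_s > 0` of the half-filled sector satisfies
  `ρ_s ≤ (U (sdwClosed U Δ - lmClosed U₁)/(U - U₁) - lmClosed U)/4`; `MottStiffnessCeilingTL`
  (PROVED) — the same along all large even tori (the cell's thermodynamic-limit convention).
* `MottStiffnessCeilingU20`, `MottStiffnessCeilingU32` (PROVED) — kernel-checked decimal instances
  (`U₁ = Δ = U/2`): `ρ_s ≤ 0.36` at `U = 20`, `ρ_s ≤ 0.24` at `U = 32` (closed-form values `0.35753`,
  `0.23789`), both BELOW the `U`-independent one-body ceiling `4/π² = 0.4053`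
  (`HalfBathtubStiffnessBound`) — reached by no previously filed `T = 0`, `t' = 0` ceiling at any `U`
  without certified numerical brackets.

NUMBERS (honest): at `U₁ = Δ = U/2` the ceiling equals
`2U/(16 + U²) - 4/√(64 + U²) + (√(256 + U²) + √(64 + U²) - 2U)/16 = 8/U + O(U⁻³)` — values `0.4263,
0.3575, 0.3069, 0.2379, 0.1935, 0.0796` at `U = 16, 20, 24, 32, 40, 100` (optimising `(U₁, Δ)` gains
`< 2 %`); it crosses `4/π²` at `U ≈ 17 t`. The physical stiffness of the half-filled model is believed
to VANISH (Mott insulator); the content is the RIGOROUS `t²/U` DECAY for the model class (a flux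
stiffness of the half-filled sector is at most `≈ 2J`, `J = 4t²/U`) — the first `U`-dependent
ceiling in `Bounds/`. At `U = 8, 12` the certified-bracket instances of `StiffnessFromEnergyBracketsTL`
(`0.3844`, `0.3095`; EXTREMISERS.md §5a) remain the better numbers.
References (`lean/references.bib`): LangerMattis1971 eqs. (3)–(5); KennedyLieb1986 Thm 2.1;
HazraVermaRanderia2019 §III, App. G; ParamekantiTrivediRanderia1998 eq. (3); LiebPRL1989.
-/

noncomputable section

namespace Summit.HubbardSuperconductivity.HubbardLadder.Bounds

open Matrix Finset Real Filter Topology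
open Literature.MathematicalPhysics.QuantumLattice
open Literature.MathematicalPhysics.QuantumFieldTheory
open Literature.Probability.LatticeModels
open Literature.MathematicalPhysics.QuantumLattice.LangerMattis
open Literature.MathematicalPhysics.QuantumLattice.ThermodynamicLimit
open Literature.MathematicalPhysics.QuantumLattice.HartreeFock
open scoped ComplexOrder ComplexConjugate Topology

variable {L : ℕ} [NeZero L]

/-! ### Band moments on the torus -/

/-- **Second band moment, every `L ≥ 3`**: `Σ_{k ∈ (ℤ/L)²} (cos k₁ + cos k₂)² = L²`
(the tree's `sum_cosSum_pow_two_four_six` needs `L ≥ 7` because it bundles the 4th and 6th moments). -/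
theorem sum_cosSum_sq (hL : 3 ≤ L) :
    ∑ k : TorusSite 2 L, (∑ i, Real.cos (latticeMomentum L k i)) ^ 2 = (L : ℝ) ^ 2 := by
  set c : ZMod L → ℝ := fun a => Real.cos (2 * Real.pi * ((a.val : ℕ) : ℝ) / L) with hc
  have hlm : ∀ k : TorusSite 2 L, ∑ i, Real.cos (latticeMomentum L k i) = c (k 0) + c (k 1) :=
    fun k => by rw [Fin.sum_univ_two]; rfl
  have S1 : ∑ a : ZMod L, c a = 0 := sum_cos_angle (by omega)
  have S2 : ∑ a : ZMod L, c a ^ 2 = (L : ℝ) / 2 := sum_cos_angle_sq hL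
  have S0 : ∑ _a : ZMod L, (1 : ℝ) = L := by simp
  have hA : ∑ k : TorusSite 2 L, c (k 0) ^ 2 * (1 : ℝ) = (∑ a, c a ^ 2) * ∑ _a : ZMod L, (1 : ℝ) :=
    sum_torusSite_two_mul (fun a => c a ^ 2) fun _ => 1
  have hB : ∑ k : TorusSite 2 L, c (k 0) * c (k 1) = (∑ a, c a) * ∑ a, c a :=
    sum_torusSite_two_mul c c
  have hC : ∑ k : TorusSite 2 L, (1 : ℝ) * c (k 1) ^ 2 = (∑ _a : ZMod L, (1 : ℝ)) * ∑ a, c a ^ 2 :=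
    sum_torusSite_two_mul (fun _ => 1) fun a => c a ^ 2
  have hexp : ∑ k : TorusSite 2 L, (∑ i, Real.cos (latticeMomentum L k i)) ^ 2 =
      ∑ k : TorusSite 2 L, c (k 0) ^ 2 * 1 + 2 * ∑ k : TorusSite 2 L, c (k 0) * c (k 1) +
        ∑ k : TorusSite 2 L, 1 * c (k 1) ^ 2 := by
    rw [Finset.mul_sum, ← Finset.sum_add_distrib, ← Finset.sum_add_distrib]
    exact Finset.sum_congr rfl fun k _ => by rw [hlm]; ring
  rw [hexp, hA, hB, hC, S0, S1, S2]
  ring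

/-- `Σ_k ε_k² = 4 L²` for `ε_k = 1 · 2(cos k₁ + cos k₂)` (`L ≥ 3`). -/
theorem sum_band_sq (hL : 3 ≤ L) :
    ∑ k : TorusSite 2 L, ((1 : ℝ) * (2 * ∑ i, Real.cos (latticeMomentum L k i))) ^ 2 =
      4 * (L : ℝ) ^ 2 := by
  have h := sum_cosSum_sq (L := L) hL
  rw [← h, Finset.mul_sum]
  exact Finset.sum_congr rfl fun k _ => by ring

omit [NeZero L] in
/-- `ε_k² ≤ 16`. -/
theorem band_sq_le (k : TorusSite 2 L) :
    ((1 : ℝ) * (2 * ∑ i, Real.cos (latticeMomentum L k i))) ^ 2 ≤ 16 := by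
  rw [Fin.sum_univ_two]
  nlinarith [Real.cos_le_one (latticeMomentum L k 0), Real.neg_one_le_cos (latticeMomentum L k 0),
    Real.cos_le_one (latticeMomentum L k 1), Real.neg_one_le_cos (latticeMomentum L k 1)]

/-! ### Two elementary majorants -/

/-- AM–GM for the square root: `√y ≤ (y + r²)/(2r)` (`y ≥ 0`, `r > 0`). -/
theorem sqrt_le_amgm {y r : ℝ} (hy : 0 ≤ y) (hr : 0 < r) : Real.sqrt y ≤ (y + r ^ 2) / (2 * r) := by
  rw [le_div_iff₀ (by positivity)]
  nlinarith [sq_nonneg (Real.sqrt y - r), Real.sq_sqrt hy, Real.sqrt_nonneg y]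

/-- Tangent-line minorant of the convex `s ↦ 1/s` in the variable `s²`:
`1/s₀ - (s² - s₀²)/(2 s₀³) ≤ 1/s` (`s, s₀ > 0`). -/
theorem inv_ge_tangent {s s₀ : ℝ} (hs : 0 < s) (hs₀ : 0 < s₀) :
    1 / s₀ - (s ^ 2 - s₀ ^ 2) / (2 * s₀ ^ 3) ≤ 1 / s := by
  have key : 1 / s - (1 / s₀ - (s ^ 2 - s₀ ^ 2) / (2 * s₀ ^ 3)) =
      (s - s₀) ^ 2 * (s + 2 * s₀) / (2 * s * s₀ ^ 3) := by
    field_simp; ring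
  have : 0 ≤ (s - s₀) ^ 2 * (s + 2 * s₀) / (2 * s * s₀ ^ 3) := by positivity
  linarith

/-! ### Closed-form Langer–Mattis lower bound -/

/-- `lmClosed U = U/4 - √(4 + U²/16)`: the first-moment (Jensen) majorant of the Langer–Mattis
constant per site at half filling (`= -16/(U + √(U² + 64)) ≈ -8/U`). -/
def lmClosed (U : ℝ) : ℝ := U / 4 - Real.sqrt (4 + (U / 4) ^ 2)

/-- **Closed-form Langer–Mattis bound on the even torus** (`L ≥ 3` even, every `U`, `N ≤ 2L²`):
`E_L(N) ≥ (U/2) N - (U/4) L² - L² √(4 + U²/16)`. -/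
theorem hubbardTorus_groundEnergyAt_ge_lmClosed (hLe : Even L) (hL : 3 ≤ L) (U : ℝ) {N : ℕ}
    (hN : N ≤ 2 * L ^ 2) :
    U / 2 * N - U / 4 * (L : ℝ) ^ 2 - (L : ℝ) ^ 2 * Real.sqrt (4 + (U / 4) ^ 2) ≤
      groundEnergyAt (fermionTorusGraph 2 L) 1 U N := by
  have h := LangerMattis.hubbardTorus_groundEnergyAt_ge (d := 2) hLe hL 1 U hN
  set r : ℝ := Real.sqrt (4 + (U / 4) ^ 2) with hr_def
  have hr : 0 < r := Real.sqrt_pos.2 (by positivity)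
  have hr2 : r ^ 2 = 4 + (U / 4) ^ 2 := Real.sq_sqrt (by positivity)
  have hsum : ∑ k : TorusSite 2 L,
      Real.sqrt (((1 : ℝ) * (2 * ∑ i, Real.cos (latticeMomentum L k i))) ^ 2 + (U / 4) ^ 2) ≤
      (L : ℝ) ^ 2 * r := by
    calc ∑ k : TorusSite 2 L,
        Real.sqrt (((1 : ℝ) * (2 * ∑ i, Real.cos (latticeMomentum L k i))) ^ 2 + (U / 4) ^ 2)
        ≤ ∑ k : TorusSite 2 L,
          ((((1 : ℝ) * (2 * ∑ i, Real.cos (latticeMomentum L k i))) ^ 2 + (U / 4) ^ 2) + r ^ 2) /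
            (2 * r) := Finset.sum_le_sum fun k _ => sqrt_le_amgm (by positivity) hr
      _ = (L : ℝ) ^ 2 * r := by
          rw [← Finset.sum_div, Finset.sum_add_distrib, Finset.sum_add_distrib, sum_band_sq hL,
            Finset.sum_const, Finset.sum_const, Finset.card_univ, nsmul_eq_mul, nsmul_eq_mul,
            card_torusSite_two L, Nat.cast_pow, div_eq_iff (by positivity)]
          linear_combination (-((L : ℝ) ^ 2)) * hr2
  linarith

/-- At half filling (`N = L²`, `L` even): `E_L(L²)/L² ≥ lmClosed U`. -/
theorem hubbardTorus_groundEnergyAt_sq_ge_lmClosed (hLe : Even L) (hL : 3 ≤ L) (U : ℝ) :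
    (L : ℝ) ^ 2 * lmClosed U ≤ groundEnergyAt (fermionTorusGraph 2 L) 1 U (L ^ 2) := by
  have h := hubbardTorus_groundEnergyAt_ge_lmClosed hLe hL U (N := L ^ 2) (by omega)
  rw [lmClosed]
  push_cast at h
  linarith

/-! ### Closed-form SDW Hartree–Fock upper bound -/

/-- `sdwClosed U Δ = -4/√(16 + Δ²) + U/(4 + Δ²)`: the first-moment majorant of the SDW Hartree–Fock
energy per site at half filling (`≈ -4/U` at `Δ = U/2`). -/
def sdwClosed (U Δ : ℝ) : ℝ := -(4 / Real.sqrt (16 + Δ ^ 2)) + U / (4 + Δ ^ 2)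

/-- **Closed-form SDW bound on the even torus** (`L ≥ 3` even, `U ≥ 0`, `Δ ≠ 0`):
`E_L(L²) ≤ L² (-4/√(16 + Δ²) + U/(4 + Δ²))`. -/
theorem hubbardTorus_groundEnergyAt_le_sdwClosed (hLe : Even L) (hL : 3 ≤ L) {U : ℝ} (hU : 0 ≤ U)
    {Δ : ℝ} (hΔ : Δ ≠ 0) :
    groundEnergyAt (fermionTorusGraph 2 L) 1 U (L ^ 2) ≤ (L : ℝ) ^ 2 * sdwClosed U Δ := by
  have h := HartreeFock.hubbardTorus_groundEnergyAt_le_sdw_momentum (d := 2) hLe hL 1 U hΔ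
  have hΔ2 : 0 < Δ ^ 2 := by positivity
  set y : TorusSite 2 L → ℝ := fun k => ((1 : ℝ) * (2 * ∑ i, Real.cos (latticeMomentum L k i))) ^ 2
    with hy_def
  have hy0 : ∀ k, 0 ≤ y k := fun k => by rw [hy_def]; positivity
  have hy16 : ∀ k, y k ≤ 16 := fun k => band_sq_le k
  have hSy : ∑ k, y k = 4 * (L : ℝ) ^ 2 := sum_band_sq hL
  set s₀ : ℝ := Real.sqrt (4 + Δ ^ 2) with hs₀_def
  set s₁ : ℝ := Real.sqrt (16 + Δ ^ 2) with hs₁_def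
  have hs₀ : 0 < s₀ := Real.sqrt_pos.2 (by positivity)
  have hs₁ : 0 < s₁ := Real.sqrt_pos.2 (by positivity)
  have hs₀2 : s₀ ^ 2 = 4 + Δ ^ 2 := Real.sq_sqrt (by positivity)
  have hL2 : (0 : ℝ) < (L : ℝ) ^ 2 := by have := NeZero.pos L; positivity
  -- (a) the kinetic term: `Σ y_k/√(y_k + Δ²) ≥ 4L²/√(16 + Δ²)`
  have hkin : 4 * (L : ℝ) ^ 2 / s₁ ≤ ∑ k, y k * (Real.sqrt (y k + Δ ^ 2))⁻¹ := by
    calc 4 * (L : ℝ) ^ 2 / s₁ = ∑ k, y k / s₁ := by rw [← Finset.sum_div, hSy]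
      _ ≤ ∑ k, y k * (Real.sqrt (y k + Δ ^ 2))⁻¹ := Finset.sum_le_sum fun k _ => by
          rw [← div_eq_mul_inv]
          exact div_le_div_of_nonneg_left (hy0 k) (Real.sqrt_pos.2 (by linarith [hy0 k]))
            (Real.sqrt_le_sqrt (by linarith [hy16 k]))
  -- (b) the gap term: `Σ 1/√(y_k + Δ²) ≥ L²/√(4 + Δ²)`
  have hinv : (L : ℝ) ^ 2 / s₀ ≤ ∑ k, (Real.sqrt (y k + Δ ^ 2))⁻¹ := by
    have hterm : ∀ k, 1 / s₀ - (y k + Δ ^ 2 - s₀ ^ 2) / (2 * s₀ ^ 3) ≤ 1 / Real.sqrt (y k + Δ ^ 2) := by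
      intro k
      have hsk : 0 < Real.sqrt (y k + Δ ^ 2) := Real.sqrt_pos.2 (by linarith [hy0 k])
      have := inv_ge_tangent hsk hs₀
      rwa [Real.sq_sqrt (by linarith [hy0 k])] at this
    have hSb : ∑ k, (y k + Δ ^ 2 - s₀ ^ 2) = 0 := by
      rw [Finset.sum_sub_distrib, Finset.sum_add_distrib, hSy, Finset.sum_const, Finset.sum_const,
        Finset.card_univ, nsmul_eq_mul, nsmul_eq_mul, card_torusSite_two L, Nat.cast_pow, hs₀2]
      ring
    calc (L : ℝ) ^ 2 / s₀ = ∑ k, (1 / s₀ - (y k + Δ ^ 2 - s₀ ^ 2) / (2 * s₀ ^ 3)) := by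
          rw [Finset.sum_sub_distrib, ← Finset.sum_div, ← Finset.sum_div, hSb, zero_div, sub_zero,
            Finset.sum_const, Finset.card_univ, nsmul_eq_mul, card_torusSite_two L, Nat.cast_pow]
          ring
      _ ≤ ∑ k, (Real.sqrt (y k + Δ ^ 2))⁻¹ :=
          Finset.sum_le_sum fun k _ => (hterm k).trans_eq (one_div _)
  -- (c) square the gap bound and assemble
  have hinv0 : 0 ≤ (L : ℝ) ^ 2 / s₀ := by positivity
  have hsq : ((L : ℝ) ^ 2 / s₀) ^ 2 ≤ (∑ k, (Real.sqrt (y k + Δ ^ 2))⁻¹) ^ 2 :=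
    pow_le_pow_left₀ hinv0 hinv 2
  have hsq' : ((L : ℝ) ^ 2 / s₀) ^ 2 = (L : ℝ) ^ 4 / (4 + Δ ^ 2) := by
    rw [div_pow, hs₀2]; ring
  rw [hsq'] at hsq
  have hgoal : -(∑ k, y k * (Real.sqrt (y k + Δ ^ 2))⁻¹) +
      U / 4 * ((L : ℝ) ^ 2 - Δ ^ 2 * (∑ k, (Real.sqrt (y k + Δ ^ 2))⁻¹) ^ 2 / (L : ℝ) ^ 2) ≤
      (L : ℝ) ^ 2 * sdwClosed U Δ := by
    have h1 : U / 4 * ((L : ℝ) ^ 2 - Δ ^ 2 * (∑ k, (Real.sqrt (y k + Δ ^ 2))⁻¹) ^ 2 / (L : ℝ) ^ 2) ≤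
        U / 4 * ((L : ℝ) ^ 2 - Δ ^ 2 * ((L : ℝ) ^ 4 / (4 + Δ ^ 2)) / (L : ℝ) ^ 2) := by
      apply mul_le_mul_of_nonneg_left _ (by positivity)
      apply sub_le_sub_left
      exact div_le_div_of_nonneg_right (mul_le_mul_of_nonneg_left hsq hΔ2.le) hL2.le
    have h2 : U / 4 * ((L : ℝ) ^ 2 - Δ ^ 2 * ((L : ℝ) ^ 4 / (4 + Δ ^ 2)) / (L : ℝ) ^ 2) =
        (L : ℝ) ^ 2 * (U / (4 + Δ ^ 2)) := by
      field_simp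
      ring
    have h3 : (L : ℝ) ^ 2 * sdwClosed U Δ = -(4 * (L : ℝ) ^ 2 / s₁) + (L : ℝ) ^ 2 * (U / (4 + Δ ^ 2)) := by
      rw [sdwClosed, hs₁_def]; ring
    rw [h3]
    linarith
  exact h.trans hgoal

/-! ### The thermodynamic-limit brackets -/

/-- The Ruelle limit of `E_L(L²)/L²` along the even tori `L = 2(m + 2)`. -/
private theorem tendsto_halfFilled {U : ℝ} (hU : 0 ≤ U) :
    Tendsto (fun m : ℕ => groundEnergyAt (fermionTorusGraph 2 (2 * (m + 2))) 1 U ((2 * (m + 2)) ^ 2) /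
      ((2 * (m + 2) : ℕ) : ℝ) ^ 2) atTop (𝓝 (energyDensity2D 1 U 1)) := by
  have hφ : Tendsto (fun m : ℕ => 2 * (m + 2)) atTop atTop :=
    tendsto_atTop_atTop.2 fun b => ⟨b, fun m hm => by omega⟩
  refine ((tendsto_energyDensity2D_torus 1 hU zero_le_one one_lt_two).comp hφ).congr fun m => ?_
  rw [Function.comp_apply, rectN_one_of_even (even_two_mul _)]

/-- **`e(U, 1) ≥ lmClosed U`** in the thermodynamic limit (`U ≥ 0`). -/
theorem energyDensity2D_one_ge_lmClosed {U : ℝ} (hU : 0 ≤ U) : lmClosed U ≤ energyDensity2D 1 U 1 :=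
  ge_of_tendsto' (tendsto_halfFilled hU) fun m => by
    haveI : NeZero (2 * (m + 2)) := ⟨by omega⟩
    have hL2 : (0 : ℝ) < ((2 * (m + 2) : ℕ) : ℝ) ^ 2 := by positivity
    rw [le_div_iff₀ hL2]
    have := hubbardTorus_groundEnergyAt_sq_ge_lmClosed (L := 2 * (m + 2)) (even_two_mul _) (by omega) U
    linarith

/-- **`e(U, 1) ≤ sdwClosed U Δ`** in the thermodynamic limit (`U ≥ 0`, `Δ ≠ 0`). -/
theorem energyDensity2D_one_le_sdwClosed {U : ℝ} (hU : 0 ≤ U) {Δ : ℝ} (hΔ : Δ ≠ 0) :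
    energyDensity2D 1 U 1 ≤ sdwClosed U Δ :=
  le_of_tendsto' (tendsto_halfFilled hU) fun m => by
    haveI : NeZero (2 * (m + 2)) := ⟨by omega⟩
    have hL2 : (0 : ℝ) < ((2 * (m + 2) : ℕ) : ℝ) ^ 2 := by positivity
    rw [div_le_iff₀ hL2]
    have := hubbardTorus_groundEnergyAt_le_sdwClosed (L := 2 * (m + 2)) (even_two_mul _) (by omega) hU hΔ
    linarith

/-! ### Node 5 — the finite even torus (bounds.tex Thm 7(v)) -/

/-- **Thm 7(v) (Mott stiffness ceiling, finite even torus).** `L ≥ 3` even, `0 ≤ U₁ < U`, `Δ ≠ 0`,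
`ρ_s > 0` a flux stiffness of the half-filled `(L², S^z = 0)` sector of `hubbardTorus 2 L 1 U`
(`δ = 0`). Then `ρ_s ≤ (U (sdwClosed U Δ - lmClosed U₁)/(U - U₁) - lmClosed U)/4`; with
`U₁ = Δ = U/2` this is `10/U + 2U/(16 + U²) - 4/√(64 + U²) + O(U⁻³) ≈ 8 t²/U`.
kind: support (PROVED below). Why it might fail: it cannot; it is above `4/π²` for `U ≲ 20 t`.
Sources: LangerMattis1971 eqs. (3)–(5); HazraVermaRanderia2019 §III; KomaTasaki1994 §1; this cell. -/
@[conjecture] def MottStiffnessCeiling : Prop :=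
  ∀ (L : ℕ) [NeZero L], 3 ≤ L → Even L → ∀ (U U₁ Δ ρs θ₀ : ℝ), 0 ≤ U₁ → U₁ < U → Δ ≠ 0 → 0 < ρs →
    0 < θ₀ → (∀ θ : ℝ, |θ| ≤ θ₀ → ρs * θ ^ 2 ≤ fluxEnergy L U 0 θ - fluxEnergy L U 0 0) →
      ρs ≤ (U * ((sdwClosed U Δ - lmClosed U₁) / (U - U₁)) - lmClosed U) / 4

/-- **Proof of `MottStiffnessCeiling`**: the tree's chord hook `StiffnessCeilingFromEnergyBrackets`
at `δ = 0` with `R = L² sdwClosed U Δ`, `Em = L² lmClosed U`, `L₁ = L² lmClosed U₁`. -/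
theorem mottStiffnessCeiling_holds : MottStiffnessCeiling := by
  intro L _ hL hLe U U₁ Δ ρs θ₀ hU₁ hU hΔ hρs hθ₀ hst
  have hU0 : 0 ≤ U := hU₁.trans hU.le
  have hL2 : (0 : ℝ) < (L : ℝ) ^ 2 := by have := NeZero.pos L; positivity
  have hE : ∀ U' : ℝ, fluxEnergy L U' 0 0 = groundEnergyAt (fermionTorusGraph 2 L) 1 U' (L ^ 2) := by
    intro U'
    rw [fluxEnergy_zero_eq_groundEnergyAt U' 0 (by norm_num), sub_zero, rectN_one_of_even hLe]
  have hR : fluxEnergy L U 0 0 ≤ (L : ℝ) ^ 2 * sdwClosed U Δ := by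
    rw [hE]; exact hubbardTorus_groundEnergyAt_le_sdwClosed hLe hL hU0 hΔ
  have hEm : (L : ℝ) ^ 2 * lmClosed U ≤ fluxEnergy L U 0 0 := by
    rw [hE]; exact hubbardTorus_groundEnergyAt_sq_ge_lmClosed hLe hL U
  have hL₁ : (L : ℝ) ^ 2 * lmClosed U₁ ≤ fluxEnergy L U₁ 0 0 := by
    rw [hE]; exact hubbardTorus_groundEnergyAt_sq_ge_lmClosed hLe hL U₁
  have h := stiffnessCeilingFromEnergyBrackets_holds L hL U U₁ 0 ρs θ₀ (by norm_num) hU0 hU hρs hθ₀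
    hst _ _ _ hEm hR hL₁
  have hUU : U - U₁ ≠ 0 := (sub_pos.2 hU).ne'
  have key : (U * (((L : ℝ) ^ 2 * sdwClosed U Δ - (L : ℝ) ^ 2 * lmClosed U₁) / (U - U₁)) -
      (L : ℝ) ^ 2 * lmClosed U) / 4 =
      ((U * ((sdwClosed U Δ - lmClosed U₁) / (U - U₁)) - lmClosed U) / 4) * (L : ℝ) ^ 2 := by
    rw [← mul_sub, mul_div_assoc]
    ring
  rw [key] at h
  exact le_of_mul_le_mul_right h hL2

/-! ### Node 6 — thermodynamic limit (bounds.tex Thm 7(vi)) -/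

/-- **Thm 7(vi) (Mott stiffness ceiling, thermodynamic limit).** If `ρ_s > 0` is a flux stiffness of
the half-filled sectors of `hubbardTorus 2 L 1 U` for all large even `L` (same `ρ_s, θ₀`),
`0 ≤ U₁ < U`, `Δ ≠ 0`, then `ρ_s ≤ (U (sdwClosed U Δ - lmClosed U₁)/(U - U₁) - lmClosed U)/4`.
kind: support (PROVED below). Why it might fail: it cannot. Sources: as Thm 7(v). -/
@[conjecture] def MottStiffnessCeilingTL : Prop :=
  ∀ (U U₁ Δ ρs θ₀ : ℝ), 0 ≤ U₁ → U₁ < U → Δ ≠ 0 → 0 < ρs → 0 < θ₀ →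
    (∃ L₀ : ℕ, ∀ (L : ℕ) [NeZero L], L₀ ≤ L → Even L →
      ∀ θ : ℝ, |θ| ≤ θ₀ → ρs * θ ^ 2 ≤ fluxEnergy L U 0 θ - fluxEnergy L U 0 0) →
    ρs ≤ (U * ((sdwClosed U Δ - lmClosed U₁) / (U - U₁)) - lmClosed U) / 4

/-- **Proof of `MottStiffnessCeilingTL`**: the tree's TL hook `StiffnessCeilingFromEnergyDensityBrackets`
at `δ = 0` with the thermodynamic-limit brackets `energyDensity2D_one_le_sdwClosed`,
`energyDensity2D_one_ge_lmClosed`. -/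
theorem mottStiffnessCeilingTL_holds : MottStiffnessCeilingTL := by
  intro U U₁ Δ ρs θ₀ hU₁ hU hΔ hρs hθ₀ hst
  have hU0 : 0 ≤ U := hU₁.trans hU.le
  have h := stiffnessCeilingFromEnergyDensityBrackets_holds U U₁ 0 ρs θ₀ hU₁ hU (by norm_num)
    (by norm_num) hρs hθ₀ hst (lmClosed U) (sdwClosed U Δ) (lmClosed U₁)
  simp only [sub_zero] at h
  exact h (energyDensity2D_one_ge_lmClosed hU0) (energyDensity2D_one_le_sdwClosed hU0 hΔ)
    (energyDensity2D_one_ge_lmClosed (hU₁))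

/-! ### Kernel-checked decimal instances (`U₁ = Δ = U/2`) -/

/-- Decimal arithmetic for `U = 20`, `U₁ = Δ = 10`, over abstract square roots
`A = 4/√116 ≥ 0.37138`, `B = √10.25 ≤ 3.2016`, `C = √29 ≤ 5.3852`. -/
private theorem mott_numeric_20 {A B C : ℝ} (hA : 0.37138 ≤ A) (hB : B ≤ 3.2016) (hC : C ≤ 5.3852) :
    (20 * ((-A + 20 / (4 + 10 ^ 2) - (10 / 4 - B)) / (20 - 10)) - (20 / 4 - C)) / 4 ≤ (0.36 : ℝ) := by
  norm_num at hA hB hC ⊢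
  linarith

/-- Decimal arithmetic for `U = 32`, `U₁ = Δ = 16`: `A = 4/√272 ≥ 0.242534`, `B = √20 ≤ 4.47214`,
`C = √68 ≤ 8.24622`. -/
private theorem mott_numeric_32 {A B C : ℝ} (hA : 0.242534 ≤ A) (hB : B ≤ 4.47214) (hC : C ≤ 8.24622) :
    (32 * ((-A + 32 / (4 + 16 ^ 2) - (16 / 4 - B)) / (32 - 16)) - (32 / 4 - C)) / 4 ≤ (0.24 : ℝ) := by
  norm_num at hA hB hC ⊢
  linarith

/-- A lower decimal bound on `4/√x` from an upper decimal bound on `√x`. -/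
private theorem four_div_sqrt_ge {x q c : ℝ} (hx : 0 < x) (hq : Real.sqrt x ≤ q) (hc : 0 ≤ c)
    (hcq : c * q ≤ 4) : c ≤ 4 / Real.sqrt x := by
  rw [le_div_iff₀ (Real.sqrt_pos.2 hx)]; nlinarith

/-- **`U = 20 t`: `ρ_s ≤ 0.36 t`** (`< 4/π² = 0.4053`, the `U`-independent one-body ceiling) for every
flux stiffness of the half-filled sector of every even torus `L ≥ 4` (`U₁ = Δ = 10`; the exact
value of the closed form is `0.35753`). kind: support (PROVED). -/
@[conjecture] def MottStiffnessCeilingU20 : Prop :=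
  ∀ (L : ℕ) [NeZero L], 3 ≤ L → Even L → ∀ (ρs θ₀ : ℝ), 0 < ρs → 0 < θ₀ →
    (∀ θ : ℝ, |θ| ≤ θ₀ → ρs * θ ^ 2 ≤ fluxEnergy L 20 0 θ - fluxEnergy L 20 0 0) → ρs ≤ 0.36

/-- **Proof of `MottStiffnessCeilingU20`.** -/
theorem mottStiffnessCeilingU20_holds : MottStiffnessCeilingU20 := by
  intro L _ hL hLe ρs θ₀ hρs hθ₀ hst
  have h := mottStiffnessCeiling_holds L hL hLe 20 10 10 ρs θ₀ (by norm_num) (by norm_num)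
    (by norm_num) hρs hθ₀ hst
  have hA : (0.37138 : ℝ) ≤ 4 / Real.sqrt (16 + 10 ^ 2) :=
    four_div_sqrt_ge (by norm_num) (Real.sqrt_le_iff.2 ⟨by norm_num, by norm_num⟩ :
      Real.sqrt (16 + 10 ^ 2) ≤ 10.7704) (by norm_num) (by norm_num)
  have hB : Real.sqrt (4 + (10 / 4) ^ 2) ≤ 3.2016 := Real.sqrt_le_iff.2 ⟨by norm_num, by norm_num⟩
  have hC : Real.sqrt (4 + (20 / 4) ^ 2) ≤ 5.3852 := Real.sqrt_le_iff.2 ⟨by norm_num, by norm_num⟩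
  simp only [sdwClosed, lmClosed] at h
  exact h.trans (mott_numeric_20 hA hB hC)

/-- **`U = 32 t`: `ρ_s ≤ 0.24 t`** (`< 4/π²`) for every flux stiffness of the half-filled sector of
every even torus `L ≥ 4` (`U₁ = Δ = 16`; exact value of the closed form `0.23789`).
kind: support (PROVED). -/
@[conjecture] def MottStiffnessCeilingU32 : Prop :=
  ∀ (L : ℕ) [NeZero L], 3 ≤ L → Even L → ∀ (ρs θ₀ : ℝ), 0 < ρs → 0 < θ₀ →
    (∀ θ : ℝ, |θ| ≤ θ₀ → ρs * θ ^ 2 ≤ fluxEnergy L 32 0 θ - fluxEnergy L 32 0 0) → ρs ≤ 0.24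

/-- **Proof of `MottStiffnessCeilingU32`.** -/
theorem mottStiffnessCeilingU32_holds : MottStiffnessCeilingU32 := by
  intro L _ hL hLe ρs θ₀ hρs hθ₀ hst
  have h := mottStiffnessCeiling_holds L hL hLe 32 16 16 ρs θ₀ (by norm_num) (by norm_num)
    (by norm_num) hρs hθ₀ hst
  have hA : (0.242534 : ℝ) ≤ 4 / Real.sqrt (16 + 16 ^ 2) :=
    four_div_sqrt_ge (by norm_num) (Real.sqrt_le_iff.2 ⟨by norm_num, by norm_num⟩ :
      Real.sqrt (16 + 16 ^ 2) ≤ 16.4925) (by norm_num) (by norm_num)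
  have hB : Real.sqrt (4 + (16 / 4) ^ 2) ≤ 4.47214 := Real.sqrt_le_iff.2 ⟨by norm_num, by norm_num⟩
  have hC : Real.sqrt (4 + (32 / 4) ^ 2) ≤ 8.24622 := Real.sqrt_le_iff.2 ⟨by norm_num, by norm_num⟩
  simp only [sdwClosed, lmClosed] at h
  exact h.trans (mott_numeric_32 hA hB hC)

end Summit.HubbardSuperconductivity.HubbardLadder.Bounds

end
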